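import Summits.AtomisticToContinuum.Crystallization.Theorems.ChargedEnergyGapBarlowTubeH
import HarnessLib

/-!
# Charged energy gap — lens-3 g64, node «BarlowRef» (R3) — part 10: SHARP TUBE GEOMETRY for the certified numerator of `TubeShareBoundH`

Imports the tree (`…BarlowTubeH`, part 6).  ELEMENTARY·PROVED Euclidean geometry in `E3`, the two sharp inputs the certified evaluation of the
per-member load needs (memo g64 §3 «CERTIFIED-CONSTANT MODEL», addendum 7) — replacing the crude `dist y z ≥ a + b − 2r` (×5.7 loss in the
weight) and part 2's crude shadow radius `2r(a+b)/(a−r)` (×4 loss in cross-section):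

for a segment `[y, z]` passing within `r` of `c` (a point `p ∈ [y, z]` with `dist p c ≤ r`) and a source beyond the tube, `a := dist y c > r`,
`b := dist z c`, `L := dist y z`,
* `norm_sq_lineParam` — the axial/perpendicular decomposition `‖y + t•u − c‖² = (t‖u‖ − s₀)² + (‖c − y‖² − s₀²)`, `s₀ = ⟪c − y, u⟫/‖u‖`;
* ★ `sqrt_mul_dist_le_inner` — AXIAL COORDINATE: `√(a² − r²) · L ≤ ⟪c − y, z − y⟫` (the foot of the perpendicular from `c` lies beyond
  `√(a² − r²)` along the segment; in particular the inner product is positive);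
* ★ `sqrt_add_sqrt_le_dist` — PERPENDICULAR-FOOT WEIGHT: if also `b > r` then `√(a² − r²) + √(b² − r²) ≤ L` (so the pair weight is
  `L⁻⁶ ≤ (√(a² − r²) + √(b² − r²))⁻⁶`); the `infDist` form `sqrt_add_sqrt_le_dist_of_infDist_le` matches `tubeLoad`'s condition;
* ★ `norm_perp_mul_dist_le` — SHARP SHADOW CONE: the component of `z − y` orthogonal to the axis `c − y` has norm `≤ r · L / a`
  (`sin ∠ ≤ r/a`), and `norm_perp_le_shadowRadius`: `≤ r (a + b) / a`; with the axial bounds this puts the target in the cylinder of radius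
  `r(a+b)/a` about the axis through `y` and `c`, axial coordinate from `y` in `[√(a² − r²), a + b]`.

0 sorry; standard axioms.
-/

noncomputable section

open scoped Classical RealInnerProductSpace
open Literature.MathematicalPhysics.StatisticalMechanics Literature.Geometry.DiscreteGeometry
open Summit.AtomisticToContinuum.Crystallization.Theses.PricedLinkCensus
open Summit.AtomisticToContinuum.Crystallization.Theorems.ChargedEnergyGapNegative

namespace Summit.AtomisticToContinuum.Crystallization.Theorems.ChargedEnergyGapChartDial

section TubeGeometry

/-- AXIAL / PERPENDICULAR DECOMPOSITION along the line `τ ↦ y + τ • u` (`u ≠ 0`): with `s₀ := ⟪c − y, u⟫/‖u‖`,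
`‖y + t • u − c‖² = (t‖u‖ − s₀)² + (‖c − y‖² − s₀²)` (the second summand is the squared distance from `c` to the line). -/
theorem norm_sq_lineParam (y c u : E3) (t : ℝ) (hu : u ≠ 0) :
    ‖y + t • u - c‖ ^ 2 = (t * ‖u‖ - ⟪c - y, u⟫ / ‖u‖) ^ 2 + (‖c - y‖ ^ 2 - (⟪c - y, u⟫ / ‖u‖) ^ 2) := by
  have hL : ‖u‖ ≠ 0 := norm_ne_zero_iff.mpr hu
  have h1 : y + t • u - c = t • u - (c - y) := by abel
  rw [h1, norm_sub_sq_real, norm_smul, Real.norm_eq_abs, mul_pow, sq_abs, real_inner_smul_left, real_inner_comm u (c - y)]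
  field_simp
  ring

/-- A point of `[y, z]` within `r` of `c` while `dist y c > r` forces `y ≠ z`. -/
theorem ne_of_mem_segment_of_dist_le {c y z p : E3} {r : ℝ} (hp : p ∈ segment ℝ y z) (hpc : dist p c ≤ r) (hry : r < dist y c) :
    y ≠ z := by
  rintro rfl
  rw [segment_same, Set.mem_singleton_iff] at hp
  rw [hp] at hpc
  exact absurd hpc (not_le.mpr hry)

/-- ★ **AXIAL COORDINATE.**  If `p ∈ [y, z]`, `dist p c ≤ r < dist y c =: a`, then `√(a² − r²) · dist y z ≤ ⟪c − y, z − y⟫`: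
the signed axial coordinate `s₀ = ⟪c − y, z − y⟫/dist y z` of `c` along the segment is at least `√(a² − r²)` (it is positive, and
`a² − r² ≤ s₀²` because the perpendicular part of `c − y` is at most `r`). -/
theorem sqrt_mul_dist_le_inner {c y z p : E3} {r : ℝ} (hp : p ∈ segment ℝ y z) (hpc : dist p c ≤ r) (hry : r < dist y c) :
    Real.sqrt (dist y c ^ 2 - r ^ 2) * dist y z ≤ ⟪c - y, z - y⟫ := by
  have hr : 0 ≤ r := dist_nonneg.trans hpc
  have hyz : y ≠ z := ne_of_mem_segment_of_dist_le hp hpc hry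
  have hu : z - y ≠ 0 := sub_ne_zero.mpr (Ne.symm hyz)
  have hL : 0 < ‖z - y‖ := norm_pos_iff.mpr hu
  obtain ⟨t, ht, rfl⟩ : ∃ t ∈ Set.Icc (0:ℝ) 1, y + t • (z - y) = p := by
    rw [segment_eq_image'] at hp; exact hp
  set L := ‖z - y‖ with hL_def
  set s₀ := ⟪c - y, z - y⟫ / L with hs₀
  set d2 := ‖c - y‖ ^ 2 - s₀ ^ 2 with hd2
  have key : ‖y + t • (z - y) - c‖ ^ 2 = (t * L - s₀) ^ 2 + d2 := norm_sq_lineParam y c (z - y) t hu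
  have hpc2 : (t * L - s₀) ^ 2 + d2 ≤ r ^ 2 := by
    rw [← key, ← dist_eq_norm]; exact pow_le_pow_left₀ dist_nonneg hpc 2
  have ha : dist y c ^ 2 = s₀ ^ 2 + d2 := by rw [hd2, dist_eq_norm, norm_sub_rev]; ring
  have har : r ^ 2 < dist y c ^ 2 := by
    exact pow_lt_pow_left₀ hry hr two_ne_zero
  -- s₀ ≥ 0: otherwise (tL − s₀)² ≥ s₀² and a² ≤ r²
  have htL : 0 ≤ t * L := mul_nonneg ht.1 hL.le
  have hs₀pos : 0 ≤ s₀ := by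
    by_contra h
    rw [not_le] at h
    have h1 : s₀ ^ 2 ≤ (t * L - s₀) ^ 2 := by nlinarith
    nlinarith
  have hsq : dist y c ^ 2 - r ^ 2 ≤ s₀ ^ 2 := by nlinarith [sq_nonneg (t * L - s₀)]
  have hroot : Real.sqrt (dist y c ^ 2 - r ^ 2) ≤ s₀ := by
    calc Real.sqrt (dist y c ^ 2 - r ^ 2) ≤ Real.sqrt (s₀ ^ 2) := Real.sqrt_le_sqrt hsq
      _ = s₀ := Real.sqrt_sq hs₀pos
  have hinner : ⟪c - y, z - y⟫ = s₀ * L := by rw [hs₀, div_mul_cancel₀ _ hL.ne']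
  have hLyz : dist y z = L := by rw [hL_def, dist_eq_norm, norm_sub_rev]
  rw [hinner, hLyz]
  exact mul_le_mul_of_nonneg_right hroot hL.le

/-- ★ **PERPENDICULAR-FOOT WEIGHT LEMMA.**  If `p ∈ [y, z]`, `dist p c ≤ r`, `r < a := dist y c` and `r < b := dist z c`, then
`√(a² − r²) + √(b² − r²) ≤ dist y z`.  (Apply the axial bound from both ends: `⟪c − y, z − y⟫ + ⟪c − z, y − z⟫ = ‖z − y‖²`.)
The crude `a + b − 2r ≤ dist y z` loses a factor ≈ 5.7 in the weight `(dist y z)⁻⁶` at the record dials; this is the sharp form. -/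
theorem sqrt_add_sqrt_le_dist {c y z p : E3} {r : ℝ} (hp : p ∈ segment ℝ y z) (hpc : dist p c ≤ r) (hry : r < dist y c)
    (hrz : r < dist z c) :
    Real.sqrt (dist y c ^ 2 - r ^ 2) + Real.sqrt (dist z c ^ 2 - r ^ 2) ≤ dist y z := by
  have hyz : y ≠ z := ne_of_mem_segment_of_dist_le hp hpc hry
  have hL : 0 < dist y z := dist_pos.mpr hyz
  have h1 := sqrt_mul_dist_le_inner hp hpc hry
  have hp' : p ∈ segment ℝ z y := by rw [segment_symm]; exact hp
  have h2 := sqrt_mul_dist_le_inner hp' hpc hrz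
  rw [dist_comm z y] at h2
  have hsum : ⟪c - y, z - y⟫ + ⟪c - z, y - z⟫ = dist y z ^ 2 := by
    have e1 : c - z = (c - y) - (z - y) := by abel
    have e2 : y - z = -(z - y) := by abel
    rw [e1, e2, inner_neg_right, inner_sub_left (c - y) (z - y) (z - y), real_inner_self_eq_norm_sq, dist_eq_norm, norm_sub_rev]; ring
  have h3 : (Real.sqrt (dist y c ^ 2 - r ^ 2) + Real.sqrt (dist z c ^ 2 - r ^ 2)) * dist y z ≤ dist y z * dist y z := by
    rw [add_mul, ← sq, ← hsum]; exact add_le_add h1 h2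
  exact le_of_mul_le_mul_right h3 hL

/-- The `infDist` form matching `tubeLoad`'s condition: `Metric.infDist c (segment ℝ y z) ≤ r`, `r < dist y c`, `r < dist z c` ⟹
`√(dist y c² − r²) + √(dist z c² − r²) ≤ dist y z`. -/
theorem sqrt_add_sqrt_le_dist_of_infDist_le {c y z : E3} {r : ℝ} (h : Metric.infDist c (segment ℝ y z) ≤ r) (hry : r < dist y c)
    (hrz : r < dist z c) :
    Real.sqrt (dist y c ^ 2 - r ^ 2) + Real.sqrt (dist z c ^ 2 - r ^ 2) ≤ dist y z := by
  obtain ⟨p, hp, hpc⟩ := exists_mem_segment_dist_le h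
  exact sqrt_add_sqrt_le_dist hp hpc hry hrz

/-- The weight consequence: under the same hypotheses `(dist y z)⁻¹ ^ 6 ≤ (√(dist y c² − r²) + √(dist z c² − r²))⁻¹ ^ 6`. -/
theorem inv_dist_pow_six_le_of_infDist_le {c y z : E3} {r : ℝ} (h : Metric.infDist c (segment ℝ y z) ≤ r) (hry : r < dist y c)
    (hrz : r < dist z c) :
    (dist y z)⁻¹ ^ 6 ≤ (Real.sqrt (dist y c ^ 2 - r ^ 2) + Real.sqrt (dist z c ^ 2 - r ^ 2))⁻¹ ^ 6 := by
  have hr : 0 ≤ r := Metric.infDist_nonneg.trans h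
  have ha : 0 < dist y c ^ 2 - r ^ 2 := by nlinarith [pow_lt_pow_left₀ hry hr two_ne_zero]
  have hpos : 0 < Real.sqrt (dist y c ^ 2 - r ^ 2) + Real.sqrt (dist z c ^ 2 - r ^ 2) :=
    add_pos_of_pos_of_nonneg (Real.sqrt_pos.mpr ha) (Real.sqrt_nonneg _)
  have hle := sqrt_add_sqrt_le_dist_of_infDist_le h hry hrz
  exact pow_le_pow_left₀ (inv_nonneg.mpr (hpos.le.trans hle)) (inv_anti₀ hpos hle) 6

/-- ★ **SHARP SHADOW CONE.**  If `p ∈ [y, z]`, `dist p c ≤ r < a := dist y c`, then the component of `z − y` orthogonal to the axis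
`c − y` satisfies `‖(z − y) − (⟪z − y, c − y⟫/a²) • (c − y)‖ · a ≤ r · dist y z` — the direction `y → z` makes an angle of sine `≤ r/a`
with the direction `y → c` (`a²·‖perp‖² = ‖z − y‖²·a² − ⟪z − y, c − y⟫² = ‖z − y‖² · dist(c, line)² ≤ ‖z − y‖² r²`). -/
theorem norm_perp_mul_dist_le {c y z p : E3} {r : ℝ} (hp : p ∈ segment ℝ y z) (hpc : dist p c ≤ r) (hry : r < dist y c) :
    ‖(z - y) - (⟪z - y, c - y⟫ / dist y c ^ 2) • (c - y)‖ * dist y c ≤ r * dist y z := by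
  have hr : 0 ≤ r := dist_nonneg.trans hpc
  have ha : 0 < dist y c := hr.trans_lt hry
  have hyz : y ≠ z := ne_of_mem_segment_of_dist_le hp hpc hry
  have hu : z - y ≠ 0 := sub_ne_zero.mpr (Ne.symm hyz)
  have hL : 0 < ‖z - y‖ := norm_pos_iff.mpr hu
  obtain ⟨t, ht, rfl⟩ : ∃ t ∈ Set.Icc (0:ℝ) 1, y + t • (z - y) = p := by
    rw [segment_eq_image'] at hp; exact hp
  set L := ‖z - y‖ with hL_def
  set s₀ := ⟪c - y, z - y⟫ / L with hs₀
  set d2 := ‖c - y‖ ^ 2 - s₀ ^ 2 with hd2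
  have key : ‖y + t • (z - y) - c‖ ^ 2 = (t * L - s₀) ^ 2 + d2 := norm_sq_lineParam y c (z - y) t hu
  have hpc2 : (t * L - s₀) ^ 2 + d2 ≤ r ^ 2 := by
    rw [← key, ← dist_eq_norm]; exact pow_le_pow_left₀ dist_nonneg hpc 2
  have hd2r : d2 ≤ r ^ 2 := by nlinarith [sq_nonneg (t * L - s₀)]
  have hav : ‖c - y‖ = dist y c := by rw [dist_eq_norm, norm_sub_rev]
  have hinner : ⟪z - y, c - y⟫ = s₀ * L := by rw [real_inner_comm, hs₀, div_mul_cancel₀ _ hL.ne']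
  -- ‖perp‖² · a² = L² a² − ⟪u, v⟫² = L² · d2
  have hperp : ‖(z - y) - (⟪z - y, c - y⟫ / dist y c ^ 2) • (c - y)‖ ^ 2 * dist y c ^ 2 = L ^ 2 * d2 := by
    rw [norm_sub_sq_real, norm_smul, mul_pow, Real.norm_eq_abs, sq_abs, real_inner_smul_right, hav, hinner, hd2, hav]
    field_simp
    ring
  have hsq : (‖(z - y) - (⟪z - y, c - y⟫ / dist y c ^ 2) • (c - y)‖ * dist y c) ^ 2 ≤ (r * dist y z) ^ 2 := by
    rw [mul_pow, hperp, mul_pow, dist_eq_norm, norm_sub_rev, ← hL_def]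
    nlinarith [sq_nonneg L]
  exact (pow_le_pow_iff_left₀ (mul_nonneg (norm_nonneg _) ha.le) (mul_nonneg hr dist_nonneg) two_ne_zero).mp hsq

/-- SHADOW RADIUS `r(a+b)/a`: under the same hypotheses, with `b := dist z c`, the orthogonal component has norm `≤ r (a + b) / a`
(`dist y z ≤ a + b`).  Part 2's `tube_shadow_ball` radius `2r(a+b)/(a−r)` is twice this and about the far axis point; use this one for the
certified sums. -/
theorem norm_perp_le_shadowRadius {c y z p : E3} {r : ℝ} (hp : p ∈ segment ℝ y z) (hpc : dist p c ≤ r) (hry : r < dist y c) :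
    ‖(z - y) - (⟪z - y, c - y⟫ / dist y c ^ 2) • (c - y)‖ ≤ r * (dist y c + dist z c) / dist y c := by
  have hr : 0 ≤ r := dist_nonneg.trans hpc
  have ha : 0 < dist y c := hr.trans_lt hry
  rw [le_div_iff₀ ha]
  calc ‖(z - y) - (⟪z - y, c - y⟫ / dist y c ^ 2) • (c - y)‖ * dist y c ≤ r * dist y z := norm_perp_mul_dist_le hp hpc hry
    _ ≤ r * (dist y c + dist z c) := by
        refine mul_le_mul_of_nonneg_left ?_ hr
        calc dist y z ≤ dist y c + dist c z := dist_triangle y c z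
          _ = dist y c + dist z c := by rw [dist_comm c z]

/-- AXIAL RANGE of the target: `√(a² − r²) · dist y z ≤ ⟪z − y, c − y⟫ ≤ a · dist y z` and `dist y z ≤ a + b` — with
`norm_perp_le_shadowRadius` the target lies in the cylinder of radius `r(a+b)/a` about the axis through `y` and `c`, at axial coordinate
`⟪z − y, c − y⟫/a ∈ [√(a² − r²) · L/a, L] ⊆ [a − r, a + b]` from `y`. -/
theorem axial_range {c y z p : E3} {r : ℝ} (hp : p ∈ segment ℝ y z) (hpc : dist p c ≤ r) (hry : r < dist y c) :
    Real.sqrt (dist y c ^ 2 - r ^ 2) * dist y z ≤ ⟪z - y, c - y⟫ ∧ ⟪z - y, c - y⟫ ≤ dist y c * dist y z ∧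
      dist y z ≤ dist y c + dist z c := by
  refine ⟨?_, ?_, ?_⟩
  · rw [real_inner_comm]; exact sqrt_mul_dist_le_inner hp hpc hry
  · calc ⟪z - y, c - y⟫ ≤ ‖z - y‖ * ‖c - y‖ := real_inner_le_norm _ _
      _ = dist y c * dist y z := by rw [dist_eq_norm, dist_eq_norm, norm_sub_rev z y, norm_sub_rev c y, mul_comm]
  · calc dist y z ≤ dist y c + dist c z := dist_triangle y c z
      _ = dist y c + dist z c := by rw [dist_comm c z]

end TubeGeometry

end Summit.AtomisticToContinuum.Crystallization.Theorems.ChargedEnergyGapChartDial
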